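import Summits.HubbardSuperconductivity.HubbardSuperconductivity.Theorems.AbsenceCertificateSourcedOrderDominatesLRO
import Summits.HubbardSuperconductivity.HubbardSuperconductivity.Theorems.AbsenceCertificateCanonicalSupportingPotential
import Summits.HubbardSuperconductivity.HubbardSuperconductivity.Theorems.AbsenceCertificateOnePointSoundness

/-!
# Route `AbsenceCertificate`: the stripe-point glue (`StripePointCeiling` and `StripeSourceCeiling`
# reduced to the certificate cruxes)

Support item `stmt-HubbardSuperconductivity-9492` (`StripePointCeiling`: every `S`-witness at the
catalogued stripe point `(U, δ) = (8, 1/8)` has Scalapino constant `c ≤ 1/200`) is, inside the route,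
the composition of the engine `SourcedOrderDominatesLRO` (item 9486, landed:
`sourcedOrderDominatesLRO_proof`), the canonical supporting potential (item 9491, landed:
`canonicalSupportingPotential_proof`) and the crux `StripeSourceCeiling` (item 9487, the certifiable
bet `m_L(h) ≤ 1/20` at every supporting `μ`), which in turn is the crux `StripeOnePointCertificate`
(item 9686, a certified computation) composed with the landed `OnePointSoundness` (item 9685,
`onePointSoundness_proof`). This file lands those compositions (the planner's `stripePointCeiling_of`,
`stripeSourceCeiling_of`, `stripeSourcedVanishing_of_global`, now against the landed theorems):

* `stripePointCeiling_of_stripeSourceCeiling : StripeSourceCeiling → StripePointCeiling`;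
* `stripeSourceCeiling_of_stripeOnePointCertificate : StripeOnePointCertificate → StripeSourceCeiling`;
* `stripePointCeiling_of_stripeOnePointCertificate : StripeOnePointCertificate → StripePointCeiling`;
* `stripeSourcedVanishing_of_globalSourcedVanishing : GlobalSourcedVanishing → StripeSourcedVanishing`.

Items 9492 / 9487 / 9488 are thereby closed MODULO the cruxes 9487 / 9686 / 14356 respectively, and
nothing else. Pure logic plus `√(c/2) ≤ 1/20 ⇒ c ≤ 1/200`. No definition is introduced; the cruxes are
hypotheses, not assumptions of the tree.
-/

set_option linter.dupNamespace false

noncomputable section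

namespace Summit.HubbardSuperconductivity.HubbardSuperconductivity.Theorems.AbsenceCertificate

open Matrix Filter Literature.MathematicalPhysics.QuantumLattice Literature.Probability.LatticeModels
open Summit.HubbardSuperconductivity.HubbardSuperconductivity.Theses.AbsenceCertificate
open Summit.HubbardSuperconductivity.HubbardSuperconductivity.Theorems

/-- **`StripeSourceCeiling → StripePointCeiling`** (route `AbsenceCertificate`, glue for support item
`stmt-HubbardSuperconductivity-9492`): if the sourced `d`-wave density at `(8, μ)` stays below `1/20` for
small sources at every `μ` canonically supporting `(8, 1/8)`, then every admissible sector ground-state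
sequence at `(8, 1/8)` with an eventual floor `cL⁴ ≤ Re⟨ψ_L, Δ_d†Δ_d ψ_L⟩` has `c ≤ 1/200`: take the
supporting `μ` of `canonicalSupportingPotential_proof`; for `c > 0` the engine
`sourcedOrderDominatesLRO_proof` gives `√(c/2) - ε ≤ m_L(h₀/2) ≤ 1/20` at large even `L` for every
`ε > 0`, so `√(c/2) ≤ 1/20` and `c ≤ 1/200`. [cite: KomaTasaki1994, Theorem 2.2] -/
theorem stripePointCeiling_of_stripeSourceCeiling (hSSC : StripeSourceCeiling) : StripePointCeiling := by
  intro N ψ hNψ c hfloor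
  by_cases hc : c ≤ 0
  · linarith
  push Not at hc
  -- the supporting chemical potential at `(8, 1/8)`
  obtain ⟨μ, hμ⟩ := canonicalSupportingPotential_proof 8 (1 / 8) ⟨by norm_num, by norm_num⟩
  obtain ⟨h₀, hh₀, hceil⟩ := hSSC μ hμ
  obtain ⟨L₁, hL₁⟩ := hceil (h₀ / 2) ⟨by linarith, by linarith⟩
  -- the engine at `(8, μ)` on the given sequence
  have hψ' : ∀ L, Even L → star (ψ L) ⬝ᵥ ψ L = 1 ∧
      IsGroundStateInSector (hubbardTorus 2 L 1 8) (N L) 0 (ψ L) :=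
    fun L hL => ⟨(hNψ L hL).2.1, (hNψ L hL).2.2⟩
  have hsup' : ∀ ε : ℝ, 0 < ε → ∃ L₀ : ℕ, ∀ L : ℕ, Even L → L₀ ≤ L →
      |(hubbardTorus 2 L 1 8).minEnergyOn (szSector (N L) 0) - μ * (N L : ℝ) -
        Matrix.groundEnergy (hubbardTorusWith 2 L 1 8 μ)| ≤ ε * (L : ℝ) ^ 2 := by
    intro ε hε
    obtain ⟨L₀, hL₀⟩ := hμ ε hε
    refine ⟨L₀, fun L hLe hL => ?_⟩
    rw [(hNψ L hLe).1]
    exact hL₀ L hLe hL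
  have heng := sourcedOrderDominatesLRO_proof 8 μ N ψ hψ' hsup' c hc hfloor (h₀ / 2) (by linarith)
  -- `√(c/2) ≤ 1/20 + ε` for every `ε > 0`
  have hle : Real.sqrt (c / 2) ≤ 1 / 20 := by
    refine le_of_forall_pos_le_add fun ε hε => ?_
    obtain ⟨L₂, hL₂⟩ := heng ε hε
    haveI : NeZero (2 * (L₁ + L₂ + 1)) := ⟨by omega⟩
    have h1 := hL₁ (2 * (L₁ + L₂ + 1)) (by omega)
    have h2 := hL₂ (2 * (L₁ + L₂ + 1)) ⟨L₁ + L₂ + 1, by ring⟩ (by omega)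
    linarith
  -- hence `c/2 ≤ 1/400`
  have hsq : c / 2 ≤ (1 / 20) ^ 2 := by
    have h0 : 0 ≤ Real.sqrt (c / 2) := Real.sqrt_nonneg _
    have h1 : Real.sqrt (c / 2) ^ 2 = c / 2 := Real.sq_sqrt (by linarith)
    nlinarith
  linarith

/-- **`StripeOnePointCertificate → StripeSourceCeiling`** (glue for crux `stmt-HubbardSuperconductivity-9487`,
the planner's `stripeSourceCeiling_of`): a one-point certificate of some level `R`, uniform in the source
`h ∈ (0, h₀)` and in the supporting `μ`, certifies `dWaveSourceDensity L 8 μ h ≤ 1/20` on all large tori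
by the landed soundness theorem `onePointSoundness_proof` (item 9685). [cite: AraujoEtAl2023, §6.1] -/
theorem stripeSourceCeiling_of_stripeOnePointCertificate (hcert : StripeOnePointCertificate) :
    StripeSourceCeiling := by
  intro μ hμ
  obtain ⟨R, h₀, hh₀, hc⟩ := hcert
  exact ⟨h₀, hh₀, fun h hh => onePointSoundness_proof R 8 μ h (1 / 20) (hc μ hμ h hh)⟩

/-- **`StripeOnePointCertificate → StripePointCeiling`**: the certified computation (crux 9686) alone
settles the quantitative every-ground-state ceiling at the stripe point (composition of the two glues
above). [cite: KomaTasaki1994, Theorem 2.2] -/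
theorem stripePointCeiling_of_stripeOnePointCertificate (hcert : StripeOnePointCertificate) :
    StripePointCeiling :=
  stripePointCeiling_of_stripeSourceCeiling (stripeSourceCeiling_of_stripeOnePointCertificate hcert)

/-- **`GlobalSourcedVanishing → StripeSourcedVanishing`** (the planner's `stripeSourcedVanishing_of_global`):
the qualitative regional bet (crux 9488) is literally the instance `(U, δ) = (8, 1/8)` of the global
sourced vanishing (crux 14356). [folklore] -/
theorem stripeSourcedVanishing_of_globalSourcedVanishing (hG : GlobalSourcedVanishing) :
    StripeSourcedVanishing :=
  fun μ hμ => hG 8 (by norm_num) (1 / 8) ⟨by norm_num, by norm_num⟩ μ hμ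

end Summit.HubbardSuperconductivity.HubbardSuperconductivity.Theorems.AbsenceCertificate

end
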